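import Summits.CriticalPhenomena.PercolationContinuityZ3.Theorems.Transplant.SkelHabLevels
import Summits.CriticalPhenomena.PercolationContinuityZ3.Theorems.Transplant.SkelWinChainT
import HarnessLib

/-!
# L6.0-Ω (record) — the CORRIDOR CHAIN over the constant planar schedule `ChainPlanar.Sched` as target steps in the HABITAT-RESTRICTED window
# graph `winGraphIn G Ω` (`SkelHabLevels`, p235203): the record `Skel.HabChainData` (= stmt-g7's `WinChainData` with the pair (root, depth `Rπ`)
# replaced by a vertex set `Ω`; regions / targets / levels are `Ω ∩ φ⁻¹(planar set)`), its containments and `kitsAt_stepH` — the shape the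
# corridor residue (C) needs with `Ω := Ucor` (p3-g4's ruling 20:22:53Z on SHEAR-SCOPE §2.6: plain windows are obstructed at the cube's face
# row; with `Ω ⊆ Ucor` every region lies in the habitat by definition).  Companion: `SkelHabPackaging` (`Skel.hreach_of_habChain`)

builds on p205010 (kernel theorem, internal audit signed; external expert review pending) — nothing in this file uses p205010.
Status sentence (coordinator 2026-08-20T04:30Z): "θ(p_c) = 0 on ℤ^d, all d ≥ 2 — kernel-verified (Lean 4/Mathlib, standard axioms); internal
adversarial audit SIGNED 2026-08-20 04:29Z; external expert review pending."
Lane `prim-bschramm-*`, seat `prim-bschramm-p2` (gen 4); helper file (`--supports stmt-CriticalPhenomena-4575`).  Proofs are stmt-g7's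
(`SkelWinChainT` §2 p233419) with `Φ.Win root · Rπ ↦ Φ.WinIn Ω ·`, `winLData ↦ winLDataIn`, `winGraph ↦ winGraphIn`;
`[DecidableEq V]` binders per declaration as in `SkelWinChainT` (p3-g4's ruling (3)), so `lhyp_winIn` applies without an instance bridge.
* `HabChainData` (`Ω`, planar cells `C`, `x`, `du`, `t`, `R'`, `Rlev N j₀ j₁`, source `root`, support, rim parts); `lo/hi/pcore/pregion` (planar,
  as in `WinChainData`), `stepL i := winLDataIn Φ Ω (lo i) (hi i) root Sfin`, `stepD i := Φ.WinIn Ω (pregion i)`, `tgtT i := Φ.WinIn Ω (pcore (i+1))`,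
  `tgtE`, `stepH i : TStep (winGraphIn G Ω)`; `stepL_X`, `encl`, `tgtT_subset_stepD`, `stepD_subset`, `cube_subset_X_zero`, `tgtT_last_subset`,
  `tgtT_nonempty_of`, **`kitsAt_stepH`** (via `lhyp_winIn`).
[cite: KozmaNitzan2024, §4 Lemma 10 (p. 17), Lemma 12 (pp. 23–25), p. 30 (Step IV)]
-/

noncomputable section

open MeasureTheory ProbabilityTheory
open scoped ENNReal Classical

namespace Summit.CriticalPhenomena.PercolationContinuityZ3.Theorems

namespace Transplant

namespace Skel

open Literature.Probability.Percolation Literature.Probability.LatticeModels SimpleGraph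
open Literature.Probability.Percolation.KozmaNitzan
open Literature.Probability.Percolation.KozmaNitzan.Cells (sgOf sgOf_sign)
open KNLevels ChainPlanar

variable {V : Type} {G : SimpleGraph V} [G.LocallyFinite] (Φ : PlanarSkeletonConc G)

omit Φ in
/-- **The data of a corridor chain over the constant planar schedule in a habitat-restricted window graph** (the source is the root; the
vertex set `Ω` replaces the depth). [cite: KozmaNitzan2024, §4 Lemma 12 (pp. 23–25)] -/
structure HabChainData (V : Type) where
  /-- the vertex set of the window graph (e.g. `B_G(root, Rπ) ∩ Ucor`) -/
  Ω : Finset V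
  /-- the planar cells -/
  C : PCells
  /-- the examined macro-vertex `x` -/
  x : Site 2
  /-- the onward direction -/
  du : MDir
  /-- the planar unit `t = r / 4` -/
  t : ℕ
  /-- the planar neighbourhood radius `R' ≥ Rlev + 1` -/
  R' : ℕ
  /-- the level depth of every step -/
  Rlev : ℕ
  /-- the number of contacts demanded by Step II -/
  N : ℕ
  /-- the level window -/
  j₀ : ℕ
  /-- the level window -/
  j₁ : ℕ
  /-- the source -/
  root : V
  /-- the finite support of the weighting -/
  Sfin : Finset V
  /-- the rim part of the enlarged target of step `i` -/
  Rim : ℕ → Finset V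

namespace HabChainData

variable (P : HabChainData V)

/-- Lower corner of core `i`. [folklore] -/
def lo (i : ℕ) : Site 2 :=
  sLo P.du.1 (sgOf P.du) (P.C.cen P.x) (Sched.coreα P.t P.R' i) (Sched.coreβ P.t P.R' i) (Sched.coreW P.t P.R' i)

/-- Upper corner of core `i`. [folklore] -/
def hi (i : ℕ) : Site 2 :=
  sHi P.du.1 (sgOf P.du) (P.C.cen P.x) (Sched.coreα P.t P.R' i) (Sched.coreβ P.t P.R' i) (Sched.coreW P.t P.R' i)

/-- The planar core `i`. [folklore] -/
def pcore (i : ℕ) : Finset (Site 2) := Sched.core P.t P.R' P.du.1 (sgOf P.du) (P.C.cen P.x) i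

/-- The planar region `i`. [folklore] -/
def pregion (i : ℕ) : Finset (Site 2) := Sched.region P.t P.R' P.du.1 (sgOf P.du) (P.C.cen P.x) i

/-- **The level data of step `i`** (window levels over `Ω`). [cite: KozmaNitzan2024, §4 Lemma 10 (p. 17)] -/
def stepL (i : ℕ) : LData (winGraphIn G P.Ω) := winLDataIn Φ P.Ω (P.lo i) (P.hi i) P.root P.Sfin

/-- **The region of step `i`**: `Ω ∩ φ⁻¹ region_i`. [cite: KozmaNitzan2024, §4 Lemma 10 (p. 17: D)] -/
def stepD (i : ℕ) : Finset V := Φ.WinIn P.Ω (P.pregion i)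

/-- **The true target of step `i`**: `Ω ∩ φ⁻¹ core_{i+1}`. [cite: KozmaNitzan2024, §4 Lemma 10 (p. 17: T)] -/
def tgtT (i : ℕ) : Finset V := Φ.WinIn P.Ω (P.pcore (i + 1))

/-- **The enlarged target of step `i`**: the true target and the rim part. [cite: KozmaNitzan2024, §4 p. 30] -/
def tgtE [DecidableEq V] (i : ℕ) : Finset V := P.tgtT Φ i ∪ P.Rim i

/-- **Step `i` as a target step** in `winGraphIn G Ω` (enlarged target). [cite: KozmaNitzan2024, §4 Lemma 12 (pp. 23–25)] -/
def stepH [DecidableEq V] (i : ℕ) : TStep (winGraphIn G P.Ω) := ⟨P.stepL Φ i, P.stepD Φ i, P.tgtE Φ i, P.Rlev, P.N, P.j₀, P.j₁⟩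

/-! ### The levels, the link, the containments -/

/-- **The levels of step `i`**: `Ω ∩ φ⁻¹ sBox(coreα i - j, coreβ i + j, coreW i + j)`. [cite: KozmaNitzan2024, §4 p. 15 (B⟨j⟩)] -/
theorem stepL_X (i j : ℕ) : (P.stepL Φ i).X j =
    Φ.WinIn P.Ω (sBox P.du.1 (sgOf P.du) (P.C.cen P.x) (Sched.coreα P.t P.R' i - j) (Sched.coreβ P.t P.R' i + j)
      (Sched.coreW P.t P.R' i + j)) := by
  show winLevelIn Φ P.Ω (P.lo i) (P.hi i) j = _
  rw [winLevelIn, lo, hi, sBox_enlarge _ _ (sgOf_sign P.du)]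

/-- The first level of step `i` is `Ω ∩ φ⁻¹ core_i`. [folklore] -/
theorem stepL_X_zero (i : ℕ) : (P.stepL Φ i).X 0 = Φ.WinIn P.Ω (P.pcore i) := by
  show winLevelIn Φ P.Ω (P.lo i) (P.hi i) 0 = _
  rw [winLevelIn_zero]; rfl

/-- **The true targets link the chain**: `T'_i ⊆ X^{(i+1)}_0` (with equality). [cite: KozmaNitzan2024, §4 Lemma 12] -/
theorem tgtT_subset_X_zero_succ [DecidableEq V] (i : ℕ) : P.tgtT Φ i ⊆ (P.stepH Φ (i + 1)).L.X 0 := by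
  show P.tgtT Φ i ⊆ (P.stepL Φ (i + 1)).X 0
  rw [stepL_X_zero, tgtT]

/-- The true target lies in the enlarged target. [folklore] -/
theorem tgtT_subset_tgtE [DecidableEq V] (i : ℕ) : P.tgtT Φ i ⊆ (P.stepH Φ i).T := Finset.subset_union_left

/-- The excess part of the enlarged target is inside the rim part. [folklore] -/
theorem tgtE_sdiff_subset [DecidableEq V] (i : ℕ) : (P.stepH Φ i).T \ P.tgtT Φ i ⊆ P.Rim i := by
  intro v hv
  rw [Finset.mem_sdiff] at hv
  rcases Finset.mem_union.1 hv.1 with h | h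
  · exact absurd h hv.2
  · exact h

/-- The sources agree. [folklore] -/
theorem stepH_o [DecidableEq V] (i : ℕ) : (P.stepH Φ i).L.o = P.root := rfl

/-- The targets. [folklore] -/
theorem stepH_T [DecidableEq V] (i : ℕ) : (P.stepH Φ i).T = P.tgtE Φ i := rfl

/-- The regions. [folklore] -/
theorem stepH_D [DecidableEq V] (i : ℕ) : (P.stepH Φ i).D = P.stepD Φ i := rfl

/-- Every region lies in `Ω` (so in the habitat, when `Ω ⊆ Ucor`). [folklore] -/
theorem stepD_subset_Ω (i : ℕ) : P.stepD Φ i ⊆ P.Ω := Φ.WinIn_subset _ _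

/-- Every true target lies in `Ω`. [folklore] -/
theorem tgtT_subset_Ω (i : ℕ) : P.tgtT Φ i ⊆ P.Ω := Φ.WinIn_subset _ _

variable {P}

/-- **`X^{(i)}_{Rlev+1} ⊆ D_i`** when `Rlev + 1 ≤ R'` (planar). [cite: KozmaNitzan2024, §4 Lemma 10 (p. 17: B⟨R+1⟩ ⊆ D)] -/
theorem encl (hR : 100 * P.R' ≤ P.t) (hRl : P.Rlev + 1 ≤ P.R') {i : ℕ} (hi : i ≤ Sched.nLast) :
    (P.stepL Φ i).X (P.Rlev + 1) ⊆ P.stepD Φ i := by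
  rw [stepL_X, stepD]
  refine Φ.WinIn_mono subset_rfl ((sBox_mono (sgOf_sign P.du) _ ?_ ?_ ?_).trans
    (Sched.enlarge_core_subset_region (sgOf_sign P.du) _ hR hi)) <;> push_cast <;> omega

/-- **`T'_i ⊆ D_i`.** [folklore] -/
theorem tgtT_subset_stepD (hR : 100 * P.R' ≤ P.t) {i : ℕ} (hi : i ≤ Sched.nLast) : P.tgtT Φ i ⊆ P.stepD Φ i :=
  Φ.WinIn_mono subset_rfl (Sched.core_succ_subset_region (sgOf_sign P.du) _ hR hi)

/-- **`T_i ⊆ D_i`** when the rim part lies in the region. [folklore] -/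
theorem tgtE_subset_stepD [DecidableEq V] (hR : 100 * P.R' ≤ P.t) (hRim : ∀ i, P.Rim i ⊆ P.stepD Φ i) {i : ℕ} (hi : i ≤ Sched.nLast) :
    P.tgtE Φ i ⊆ P.stepD Φ i :=
  Finset.union_subset (tgtT_subset_stepD Φ hR hi) (hRim i)

/-- The planar core of every step is nonempty. [folklore] -/
theorem pcore_nonempty (hR : 100 * P.R' ≤ P.t) {i : ℕ} (hi : i ≤ Sched.nLast + 1) : (P.pcore i).Nonempty :=
  Sched.core_nonempty (sgOf_sign P.du) (P.C.cen P.x) hR hi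

/-- **`T'_i` is nonempty** as soon as some vertex of `Ω` has its footprint in the core. [folklore] -/
theorem tgtT_nonempty_of {i : ℕ} {v : V} (hv : v ∈ P.Ω) (hφ : Φ.φ v ∈ P.pcore (i + 1)) : (P.tgtT Φ i).Nonempty :=
  ⟨v, (Φ.mem_WinIn).2 ⟨hv, hφ⟩⟩

/-- **`D_i ⊆ Ω ∩ φ⁻¹ (Q_x ∪ H_{x,y})`** (`r = 4t`). [cite: KozmaNitzan2024, §4 p. 30 (E_{v,x} ∪ H_{x,y})] -/
theorem stepD_subset (hr : P.C.r = 4 * P.t) (hR : 100 * P.R' ≤ P.t) {i : ℕ} (hi : i ≤ Sched.nLast) :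
    P.stepD Φ i ⊆ Φ.WinIn P.Ω (P.C.Q P.x ∪ P.C.Hfull P.x P.du) :=
  Φ.WinIn_mono subset_rfl (Sched.region_subset_Q_union_Hfull hr hR hi)

/-- **The arrival cube lies in the first core**: `Ω' ∩ φ⁻¹ M_x ⊆ X^{(0)}_0` for `Ω' ⊆ Ω`. [cite: KozmaNitzan2024, §4 p. 28 ((32): M_v)] -/
theorem cube_subset_X_zero (hr : P.C.r = 4 * P.t) (hR : 100 * P.R' ≤ P.t) {Ω' : Finset V} (hΩ : Ω' ⊆ P.Ω) :
    Φ.WinIn Ω' (P.C.M P.x) ⊆ (P.stepL Φ 0).X 0 := by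
  rw [stepL_X_zero]
  refine Φ.WinIn_mono hΩ (le_of_eq ?_)
  rw [pcore, Sched.core_zero_eq_M hr hR]

/-- **The last true target lies in `Ω ∩ φ⁻¹ (M_y ∩ H_{x,y})`.** [cite: KozmaNitzan2024, §4 p. 26 (M_x, H_{v,x})] -/
theorem tgtT_last_subset (hr : P.C.r = 4 * P.t) (hR : 100 * P.R' ≤ P.t) :
    P.tgtT Φ Sched.nLast ⊆ Φ.WinIn P.Ω (P.C.M (P.x + stepVec P.du) ∩ P.C.Hfull P.x P.du) :=
  Φ.WinIn_mono subset_rfl (Finset.subset_inter (Sched.core_last_subset_M hr hR) (Sched.core_last_subset_Hfull hr hR))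

/-! ### The kits -/

/-- **`KitsAt` of the enlarged step `i`** from a subbox region in `winGraphIn G Ω`, finite support, the source off the region, a nonempty true
target, the count inequality and the per-level kit clause towards the enlarged target. [cite: KozmaNitzan2024, §4 Lemma 10 (p. 17)] -/
theorem kitsAt_stepH [DecidableEq V] (hR : 100 * P.R' ≤ P.t) (hRl : P.Rlev + 1 ≤ P.R') (hRim : ∀ i, P.Rim i ⊆ P.stepD Φ i)
    {i : ℕ} (hi : i ≤ Sched.nLast) (hTne : (P.tgtT Φ i).Nonempty) {Wt : Sym2 V → unitInterval} {p : unitInterval} {Δ : ℕ} {δ : ℝ}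
    (hsub : KNLevels.IsSubbox (winGraphIn G P.Ω) Wt p (P.stepD Φ i)) (hfin : FinSupp Wt P.Sfin) (hDS : P.stepD Φ i ⊆ P.Sfin)
    (ho : P.root ∉ P.stepD Φ i) (hoS : P.root ∈ P.Sfin) (hj : P.j₁ ≤ P.Rlev)
    (hcount : 1 / (1 - (p : ℝ)) ^ (Δ * P.N) ≤ δ * ((Finset.Icc P.j₀ P.j₁).card : ℝ))
    (hkits : ∀ j ∈ Finset.Icc P.j₀ P.j₁, ∃ (σ : SData V) (S : Finset V),
      SHyp (winLDataIn Φ P.Ω (P.lo i) (P.hi i) P.root P.Sfin) j σ ∧ σ.N ≤ P.N ∧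
      (1 - (p : ℝ) ^ σ.sB) ^ σ.k ≤ δ ∧ S ⊆ (winLDataIn Φ P.Ω (P.lo i) (P.hi i) P.root P.Sfin).X j ∧ S ⊆ P.stepD Φ i ∧
      (∀ x ∈ σ.K, ∀ e ∈ σ.seed x, e ∉ wireSet (↑S : Set V)) ∧ (∀ x ∈ σ.K, σ.face x ⊆ S) ∧
      (∀ x ∈ σ.K, 1 - 3 * δ ≤ (prodBernoulli Wt).real {ω | ∃ u ∈ σ.face x,
        1 - δ < (prodBernoulli (pinW Wt (wireSet (↑S : Set V)) ω)).real
          (⋃ t ∈ P.tgtE Φ i, openConnIn (↑(P.stepD Φ i) : Set V) u t)})) :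
    (P.stepH Φ i).KitsAt Wt p Δ δ :=
  ⟨lhyp_winIn Φ P.Ω (P.lo i) (P.hi i) hsub hfin hDS (encl Φ hR hRl hi) ho hoS, hj, tgtE_subset_stepD Φ hR hRim hi,
    hTne.mono (P.tgtT_subset_tgtE Φ i), hcount, hkits⟩

end HabChainData

end Skel

end Transplant

end Summit.CriticalPhenomena.PercolationContinuityZ3.Theorems

end
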